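import Summits.ResolutionOfSingularities.ResolutionOfSingularities.Theorems.FrobeniusClosingPatchingRelPerfectPointwiseMonomialPairStep
import Summits.ResolutionOfSingularities.ResolutionOfSingularities.Theorems.FrobeniusClosingPatchingRelPerfectDepthMixedTargetsJ
import Summits.ResolutionOfSingularities.ResolutionOfSingularities.Theorems.FrobeniusClosingPatchingRelPerfectCentreSeqExtendOpen
import HarnessLib

/-!
# Crux `PatchingRelPerfect` (stmt-ResolutionOfSingularities-16161), chain W5.2 — TargetsF5J, S-target
# `PointwisePairGame`, part 3: the induction, and `pointwisePairGame_holds` BY NAME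

[OURS · L1 W5.2 · S-target of res-L1-w52-plan-1's `…DepthMixedTargetsJ` (F5 v4, RE-KEY 07:57:17Z)] Replaces the
role of NO printed item; NOT a statement of the manuscript under review; fact-free, any dimension, no base field,
no excellence.  With parts 1–2 (`…PointwiseMonomialTransform`, `…PointwiseMonomialPairStep`): the pair game of
res-L1-w52-stub-4 (`MonomialCleanup.exists_centreSeq_isLocallyPrincipal_comap`, p504028) with simple normal
crossings of the common boundary asked ONLY AT THE POINTS OF THE COSUPPORT of `monomialIdeal A ⊔ monomialIdeal B`
(res-D-pv-009's `DepthSNC.SNCWithAt`):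

* `isLocallyPrincipal_sup_of_badPairs_eq_empty_pw` — no bad pair ⇒ locally principal (off the cosupport the
  stalk is the unit ideal);
* `principalize_pw` — the nested strong induction on `(maxVal, numMax)` of stub-4, through `exists_step_pw`;
* `exists_centreSeq_isLocallyPrincipal_comap_pw` — on a locally Noetherian scheme: regular centres over the
  cosupport, total transform locally principal; with `X` regular the top is regular
  (`CentreSeqExtend.isRegular_top_of_allRegular`, p509147);
* **`DepthTargets.pointwisePairGame_holds : DepthTargets.PointwisePairGame`** — the S-target of the mixed
  engine with boundary (`mixedEngineJ_of_targets`), closed BY NAME.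

Why pointwise and not «snc on an open neighbourhood of the cosupport + `localPairGame_holds` (p511765)»: the
latter needs the snc locus of the boundary to be OPEN near the cosupport, i.e. upper semicontinuity of orders,
which the tree (rightly) has only for excellent schemes (`isClosed_setOf_le_idealOrder`); the typed target has
no excellence hypothesis, and none is needed.

## References
* J. Kollár, *Lectures on Resolution of Singularities* (2007), (3.111) Step 3, Def. 3.25. [Kollar2007]
* R. Goward, *A simple algorithm for principalization of monomial ideals*, Trans. AMS 357 (2005), §2. [Goward2005]
-/

-- `Summit.<Summit>.<Sub>.Theorems` with `Sub = Summit` (single-conjunct summit, D-0017)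
set_option linter.dupNamespace false

noncomputable section

open CategoryTheory AlgebraicGeometry TopologicalSpace IsLocalRing
open Literature.AlgebraicGeometry.Resolution

namespace Summit.ResolutionOfSingularities.ResolutionOfSingularities.Theorems

universe u

namespace PointwisePair

open DepthSNC MonomialCleanup

/-! ## §1 No bad pair: the sum is locally principal, snc read at the points of the cosupport -/

section NoBadPair

variable {X : Scheme.{u}} {A B : List (X.IdealSheafData × ℕ)}

/-- At a point of simple normal crossings all of whose divisors satisfy `a_K ≤ b_K`, the stalk of
`monomialIdeal A ⊔ monomialIdeal B` is that of `monomialIdeal A`, a principal ideal. [folklore] -/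
theorem isPrincipal_stalkIdeal_sup_of_forall_expOf_le_pw {x : X} (hx : SNCWithAt (boundaryOf A) ⊤ x)
    (hAB : boundaryOf A = boundaryOf B)
    (h : ∀ K ∈ sheaves A, x ∈ K.support → expOf A K ≤ expOf B K) :
    (stalkIdeal (monomialIdeal A ⊔ monomialIdeal B) x).IsPrincipal := by
  haveI : IsRegularLocalRing (X.presheaf.stalk x) := hx.1
  rw [stalkIdeal_sup, sup_eq_left.mpr (stalkIdeal_monomialIdeal_le_of_forall_expOf_le hAB x h)]
  obtain ⟨g, hg, -, -⟩ := exists_generator_stalkIdeal_monomialIdeal A (x := x) fun p hp hxp =>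
    exists_generator_of_mem_of_sncWithAt hx (fst_mem_boundaryOf hp) hxp
  exact ⟨g, hg⟩

/-- **No bad pair ⇒ `monomialIdeal A ⊔ monomialIdeal B` is locally principal**, with simple normal
crossings asked only at the points of the cosupport (off it the stalk is the unit ideal). [folklore] -/
theorem isLocallyPrincipal_sup_of_badPairs_eq_empty_pw [IsLocallyNoetherian X]
    (hS : ∀ x ∈ (monomialIdeal A ⊔ monomialIdeal B).support, SNCWithAt (boundaryOf A) ⊤ x)
    (hAB : boundaryOf A = boundaryOf B) (h : badPairs A B = ∅) :
    IsLocallyPrincipal (monomialIdeal A ⊔ monomialIdeal B) := by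
  intro x
  refine isLocallyPrincipalAt_of_isPrincipal_stalkIdeal ?_
  by_cases hxS : x ∈ (monomialIdeal A ⊔ monomialIdeal B).support
  · by_cases hA : ∀ K ∈ sheaves A, x ∈ K.support → expOf A K ≤ expOf B K
    · exact isPrincipal_stalkIdeal_sup_of_forall_expOf_le_pw (hS x hxS) hAB hA
    · push Not at hA
      obtain ⟨K, hK, hxK, hlt⟩ := hA
      have hB : ∀ L ∈ sheaves B, x ∈ L.support → expOf B L ≤ expOf A L := by
        intro L hL hxL
        by_contra hlt'
        have hmem : (K, L) ∈ badPairs A B :=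
          mem_badPairs_iff.mpr ⟨hK, hL, hlt, lt_of_not_ge hlt', x, hxK, hxL⟩
        rw [h] at hmem
        exact absurd hmem (Finset.notMem_empty _)
      rw [sup_comm]
      have hx' : SNCWithAt (boundaryOf B) ⊤ x := hAB ▸ hS x hxS
      exact isPrincipal_stalkIdeal_sup_of_forall_expOf_le_pw hx' hAB.symm hB
  · rw [stalkIdeal_eq_top_of_not_mem_support hxS]
    exact ⟨1, by rw [Ideal.submodule_span_eq, Ideal.span_singleton_one]⟩

end NoBadPair


/-! ## §2 The induction -/

section Induction

/-- Prepending one blow-up step to a solution on the blow-up. [folklore] -/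
theorem exists_centreSeq_cons {X : Scheme.{u}} {A B : List (X.IdealSheafData × ℕ)} (C : X.IdealSheafData)
    {A₁ B₁ : List ((blowup C).IdealSheafData × ℕ)} (hC : Scheme.IsRegular C.subscheme)
    (hCsupp : (C.support : Set X) ⊆ (monomialIdeal A ⊔ monomialIdeal B).support)
    (hA₁ : (monomialIdeal A).comap (blowup.π C) = monomialIdeal A₁)
    (hB₁ : (monomialIdeal B).comap (blowup.π C) = monomialIdeal B₁)
    (h : ∃ s : CentreSeq (blowup C), s.AllRegular ∧
      s.CentresOver ((monomialIdeal A₁ ⊔ monomialIdeal B₁).support : Set (blowup C)) ∧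
      IsLocallyPrincipal ((monomialIdeal A₁ ⊔ monomialIdeal B₁).comap s.comp)) :
    ∃ s : CentreSeq X, s.AllRegular ∧
      s.CentresOver ((monomialIdeal A ⊔ monomialIdeal B).support : Set X) ∧
      IsLocallyPrincipal ((monomialIdeal A ⊔ monomialIdeal B).comap s.comp) := by
  obtain ⟨s, hreg, hover, hlp⟩ := h
  refine ⟨CentreSeq.cons C s, (CentreSeq.allRegular_cons C s).mpr ⟨hC, hreg⟩, ?_, ?_⟩
  · refine (CentreSeq.centresOver_cons C s _).mpr ⟨hCsupp, CentreSeq.CentresOver.mono s ?_ hover⟩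
    intro x' hx'
    have h1 : x' ∈ (((monomialIdeal A ⊔ monomialIdeal B).comap (blowup.π C)).support : Set (blowup C)) := by
      rw [Scheme.IdealSheafData.comap_sup, hA₁, hB₁]; exact hx'
    rw [Scheme.IdealSheafData.support_comap] at h1
    exact h1
  · have h : IsLocallyPrincipal ((monomialIdeal A ⊔ monomialIdeal B).comap (s.comp ≫ blowup.π C)) := by
      rw [Scheme.IdealSheafData.comap_comp, Scheme.IdealSheafData.comap_sup, hA₁, hB₁]
      exact hlp
    exact h

/-- **The induction** on the measure `(maxVal, numMax)`, lexicographically (verbatim stub-4's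
`MonomialCleanup.principalize_aux`, snc read at the points of the cosupport). [cite: Kollar2007, (3.111) Step 3] -/
theorem principalize_pw : ∀ (M n : ℕ) (X : Scheme.{u}) [IsLocallyNoetherian X]
    (A B : List (X.IdealSheafData × ℕ)),
    (∀ x ∈ (monomialIdeal A ⊔ monomialIdeal B).support, SNCWithAt (boundaryOf A) ⊤ x) →
    boundaryOf A = boundaryOf B → maxVal A B = M → numMax A B = n →
    ∃ s : CentreSeq X, s.AllRegular ∧
      s.CentresOver ((monomialIdeal A ⊔ monomialIdeal B).support : Set X) ∧
      IsLocallyPrincipal ((monomialIdeal A ⊔ monomialIdeal B).comap s.comp) := by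
  intro M
  induction M using Nat.strong_induction_on with
  | _ M ihM =>
  intro n
  induction n using Nat.strong_induction_on with
  | _ n ihn =>
  intro X _ A B hS hAB hM hn
  classical
  by_cases hemp : badPairs A B = ∅
  · -- no bad pair: already locally principal, the empty sequence does it
    refine ⟨CentreSeq.nil X, trivial, trivial, ?_⟩
    have h : IsLocallyPrincipal ((monomialIdeal A ⊔ monomialIdeal B).comap (𝟙 X)) := by
      rw [Scheme.IdealSheafData.comap_id]
      exact isLocallyPrincipal_sup_of_badPairs_eq_empty_pw hS hAB hemp
    exact h
  · have hnonempty : (badPairs A B).Nonempty := Finset.nonempty_iff_ne_empty.mpr hemp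
    obtain ⟨p₀, hp₀, hp₀v⟩ := exists_value_eq_maxVal hnonempty
    -- a step exists, on the `A`-side or (by symmetry) on the `B`-side
    obtain ⟨C, A', B', hC, hCsupp, hbd, hsnc, hA', hB', hmeas⟩ :
        ∃ (C : X.IdealSheafData) (A' B' : List ((blowup C).IdealSheafData × ℕ)),
          Scheme.IsRegular C.subscheme ∧
          (C.support : Set X) ⊆ (monomialIdeal A ⊔ monomialIdeal B).support ∧
          boundaryOf A' = boundaryOf B' ∧
          (∀ x' ∈ (monomialIdeal A' ⊔ monomialIdeal B').support, SNCWithAt (boundaryOf A') ⊤ x') ∧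
          (monomialIdeal A).comap (blowup.π C) = monomialIdeal A' ∧
          (monomialIdeal B).comap (blowup.π C) = monomialIdeal B' ∧
          (maxVal A' B' < maxVal A B ∨ (maxVal A' B' = maxVal A B ∧ numMax A' B' < numMax A B)) := by
      rcases max_choice (expOf A p₀.1 - expOf B p₀.1) (expOf B p₀.2 - expOf A p₀.2) with h | h
      · exact exists_step_pw hS hAB ⟨p₀, hp₀, by rw [← hp₀v, value, h]⟩
      · -- the `B`-side: apply the step to `(B, A)` and swap back
        have hp₀' : p₀.swap ∈ badPairs B A := by
          rw [badPairs_swap]; exact Finset.mem_map_of_mem _ hp₀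
        have hSB : ∀ x ∈ (monomialIdeal B ⊔ monomialIdeal A).support, SNCWithAt (boundaryOf B) ⊤ x := by
          intro x hx
          rw [sup_comm] at hx
          exact hAB ▸ hS x hx
        obtain ⟨C, B', A', hC, hCsupp, hbd, hsnc, hB', hA', hmeas⟩ :=
          exists_step_pw (A := B) (B := A) hSB hAB.symm
            ⟨p₀.swap, hp₀', by rw [maxVal_swap, ← hp₀v, value, h, Prod.fst_swap]⟩
        refine ⟨C, A', B', hC, by rwa [sup_comm] at hCsupp, hbd.symm, ?_, hA', hB', ?_⟩
        · intro x' hx'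
          rw [sup_comm] at hx'
          exact hbd ▸ hsnc x' hx'
        · rwa [maxVal_swap A' B', maxVal_swap A B, numMax_swap A' B', numMax_swap A B] at hmeas
    haveI : IsLocallyNoetherian (blowup C) := CentreSeq.isLocallyNoetherian_blowup C
    refine exists_centreSeq_cons C hC hCsupp hA' hB' ?_
    rcases hmeas with hlt | ⟨heq, hlt⟩
    · exact ihM _ (hM ▸ hlt) _ (blowup C) A' B' hsnc hbd rfl rfl
    · exact ihn _ (hn ▸ hlt) (blowup C) A' B' hsnc hbd (heq.trans hM) rfl

end Induction

/-! ## §3 The theorem -/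

/-- **Principalization of a pair of monomial ideals whose common boundary has simple normal crossings AT THE
POINTS OF THE COSUPPORT** (locally Noetherian scheme, any dimension): a finite sequence of blowings up with
regular centres — strata `V(K) ∩ V(L)` of two boundary divisors, over the cosupport — makes the total transform
of `monomialIdeal A ⊔ monomialIdeal B` locally principal. [cite: Kollar2007, (3.111) Step 3] [cite: Goward2005, §2] -/
theorem exists_centreSeq_isLocallyPrincipal_comap_pw {X : Scheme.{u}} [IsLocallyNoetherian X]
    (A B : List (X.IdealSheafData × ℕ)) (hAB : boundaryOf A = boundaryOf B)
    (hS : ∀ x ∈ (monomialIdeal A ⊔ monomialIdeal B).support, SNCWithAt (boundaryOf A) ⊤ x) :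
    ∃ s : CentreSeq X, s.AllRegular ∧
      s.CentresOver ((monomialIdeal A ⊔ monomialIdeal B).support : Set X) ∧
      IsLocallyPrincipal ((monomialIdeal A ⊔ monomialIdeal B).comap s.comp) :=
  principalize_pw _ _ X A B hS hAB rfl rfl

/-- **The same on a REGULAR locally Noetherian scheme, with regular top** (blowing up regular centres keeps
regularity, `CentreSeqExtend.isRegular_top_of_allRegular`). [cite: Kollar2007, (3.111) Step 3] -/
theorem exists_centreSeq_isLocallyPrincipal_comap_pw_of_isRegular {X : Scheme.{u}} [IsLocallyNoetherian X]
    (hX : Scheme.IsRegular X) (A B : List (X.IdealSheafData × ℕ)) (hAB : boundaryOf A = boundaryOf B)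
    (hS : ∀ x ∈ (monomialIdeal A ⊔ monomialIdeal B).support, SNCWithAt (boundaryOf A) ⊤ x) :
    ∃ s : CentreSeq X, s.AllRegular ∧
      s.CentresOver ((monomialIdeal A ⊔ monomialIdeal B).support : Set X) ∧
      Scheme.IsRegular s.top ∧ IsLocallyPrincipal ((monomialIdeal A ⊔ monomialIdeal B).comap s.comp) := by
  obtain ⟨s, hreg, hover, hlp⟩ := exists_centreSeq_isLocallyPrincipal_comap_pw A B hAB hS
  exact ⟨s, hreg, hover, CentreSeqExtend.isRegular_top_of_allRegular s hX hreg, hlp⟩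

end PointwisePair

namespace DepthTargets

/-- [OURS · L1 W5.2] **T5 S-target `PointwisePairGame` of TargetsF5J holds** (the pair game with simple normal
crossings asked only pointwise along the cosupport; any Noetherian regular scheme, no excellence): by
`PointwisePair.exists_centreSeq_isLocallyPrincipal_comap_pw_of_isRegular`.
[cite: Kollar2007, (3.111) Step 3] [cite: Goward2005, §2] -/
theorem pointwisePairGame_holds : PointwisePairGame := by
  intro X _ hX A B hAB hS
  exact PointwisePair.exists_centreSeq_isLocallyPrincipal_comap_pw_of_isRegular hX A B hAB hS

end DepthTargets

end Summit.ResolutionOfSingularities.ResolutionOfSingularities.Theorems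

end
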